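import Summits.ABC.StewartYu.PadicG3TwoMainChain
import Summits.ABC.StewartYu.PadicG3TwoThirdStep
import HarnessLib

/-!
# Cell abc-stewartyu, Gen-3 frame at `p = 2` (crux `Y07Two`, stmt-ABC-19659), record interface: the
# `‖Λ₀‖`-BRANCH of every k-step / third-step inequality is dominated by the GAIN branch once `Λ₀` is small —
# the record proves only the gain branches

`Summits/ABC/StewartYu/PadicG3TwoFirstBranch.lean` — cell `abc-stewartyu` (HOME `run/shared/lean/pub/abc-stewartyu/`),
route `PadicPrimesKummerThird`, seat p3 (g6, F-two lead).  Two `ℕ`-valued definitions (the smallness exponents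
`kExp`, `tExp` of a sub-step / third step of a schedule `σ : G3TwoSched`) and theorems; schedule-generic, no
numbers, no named fact.

WHY.  The numeric fields `KFinalTwo.hfinal` (`PadicG3TwoMainChain`) and `ThirdFinalTwo.hfinal`
(`PadicG3TwoThirdStep`) of the `p = 2` frame have the shape
`max (Bw·‖Λ₀‖·2ᵗ·2^{condExp 2 (2N+1) t}) (Bw/(4·2^m)^{g}) < 1/K` — the two branches of the `2`-adic Schwarz
lemma `PadicG3TwoSlabKStep.norm_g3G_le_of_zeros` (the comparison term `f − φ` of Yu 2013 Lemma 5.1, and the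
extrapolation gain `(m+2)·log 2` per zero).  Under the negated bound the frame has `‖Λ₀‖ ≤ 2^{−U}` for every
`U` below the crux threshold (`PadicG3TwoNegBound`), and as soon as `U ≥ t + condExp + (m+2)·g` the first branch
is `≤` the second (`first_le_gain`).  So the record (p1) proves ONLY the gain branches `Bw/(4·2^m)^g < 1/K`, and
the closer supplies one smallness exponent `U ≥ kExp σ I k`, `U ≥ tExp σ I` (`hL2_of_gain`, `hL3_of_gain` return
the literal `hfinal` shapes, quantified exactly as `PadicG3TwoScheduleNumerics.frameNumericsTwoC_schedTwo` wants).

WHAT THIS IS NOT: no budget line; no crux moves.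

References: K. Yu, Acta Math. 211 (2013), Lemma 5.1 and (5.19); Yu. V. Nesterenko, LNM 1819 (2003), §4.2.
-/

noncomputable section

open Finset
open Literature.NumberTheory.Transcendental
open Literature.NumberTheory.Transcendental.CW77 (heightProd)
open Literature.NumberTheory.Transcendental.CW77.Setup (Tau tauNorm)
open Literature.NumberTheory.Transcendental.PadicCW77 (condExp)

namespace Summit.ABC.StewartYu

namespace TwoSetup

variable {S : TwoSetup} (σ : S.G3TwoSched)

/-! ### The smallness exponents -/

/-- **Smallness exponent of sub-step `k` at level `I`**: `tdec I + condExp 2 (2·Nsub I k + 1) (tdec I) +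
(m+2)·gainExp I k` — with `‖Λ₀‖ ≤ 2^{−kExp}` the comparison branch of the k-step is below its gain branch.
[cite: Yu2013, Lemma 5.1 and (5.28); shape only] -/
def kExp (I k : ℕ) : ℕ :=
  σ.tdec I + condExp 2 (2 * σ.Nsub I k + 1) (σ.tdec I) + (σ.m + 2) * gainExp σ I k

/-- **Smallness exponent of the third step at level `I`**: `t₃ + condExp 2 (2·Nfin I + 1) t₃ + (m+2)·(2·Nfin I + 1)·t₃`,
`t₃ = Tfin I − T0 (I+1)`. [cite: Yu2013, Lemma 5.1 and (5.58); shape only] -/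
def tExp (I : ℕ) : ℕ :=
  (σ.Tfin I - σ.T0 (I + 1)) + condExp 2 (2 * σ.Nfin I + 1) (σ.Tfin I - σ.T0 (I + 1)) +
    (σ.m + 2) * ((2 * σ.Nfin I + 1) * (σ.Tfin I - σ.T0 (I + 1)))

/-! ### The comparison branch is below the gain branch -/

/-- `(4·2^m)^g = 2^{(m+2)·g}`. [folklore] -/
theorem four_mul_two_pow_pow (m g : ℕ) : (4 * (2 : ℝ) ^ m) ^ g = (2 : ℝ) ^ ((m + 2) * g) := by
  rw [show (4 : ℝ) * 2 ^ m = 2 ^ (m + 2) by rw [pow_add]; norm_num; ring, ← pow_mul]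

/-- **The comparison branch is dominated by the gain branch** when `‖Λ₀‖ ≤ 2^{−(t + c + (m+2)·g)}`:
`Bw·‖Λ₀‖·2ᵗ·2ᶜ ≤ Bw/(4·2^m)^g`. [cite: Yu2013, Lemma 5.1; shape only] -/
theorem first_le_gain {Bw Λ : ℝ} (hBw : 0 ≤ Bw) {m t c g : ℕ}
    (hΛ : Λ ≤ ((2 : ℝ) ^ (t + c + (m + 2) * g))⁻¹) :
    Bw * Λ * (2 : ℝ) ^ t * (2 : ℝ) ^ c ≤ Bw / (4 * (2 : ℝ) ^ m) ^ g := by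
  rw [four_mul_two_pow_pow, div_eq_mul_inv]
  have h2 : (0 : ℝ) < (2 : ℝ) ^ t * (2 : ℝ) ^ c := by positivity
  have key : Λ * ((2 : ℝ) ^ t * (2 : ℝ) ^ c) ≤ ((2 : ℝ) ^ ((m + 2) * g))⁻¹ := by
    calc Λ * ((2 : ℝ) ^ t * (2 : ℝ) ^ c)
        ≤ ((2 : ℝ) ^ (t + c + (m + 2) * g))⁻¹ * ((2 : ℝ) ^ t * (2 : ℝ) ^ c) :=
          mul_le_mul_of_nonneg_right hΛ h2.le
      _ = ((2 : ℝ) ^ ((m + 2) * g))⁻¹ := by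
          rw [pow_add, pow_add, mul_inv, mul_inv]
          field_simp
  calc Bw * Λ * (2 : ℝ) ^ t * (2 : ℝ) ^ c = Bw * (Λ * ((2 : ℝ) ^ t * (2 : ℝ) ^ c)) := by ring
    _ ≤ Bw * ((2 : ℝ) ^ ((m + 2) * g))⁻¹ := mul_le_mul_of_nonneg_left key hBw

/-- Smallness is monotone in the exponent: `‖Λ₀‖ ≤ 2^{−U}` and `e ≤ U` give `‖Λ₀‖ ≤ 2^{−e}`. [folklore] -/
theorem le_inv_two_pow_of_le {Λ : ℝ} {U e : ℕ} (he : e ≤ U) (hΛ : Λ ≤ ((2 : ℝ) ^ U)⁻¹) :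
    Λ ≤ ((2 : ℝ) ^ e)⁻¹ :=
  hΛ.trans (inv_anti₀ (by positivity) (pow_le_pow_right₀ (by norm_num) he))

/-- **One k-step inequality from its gain branch**: with `‖Λ₀‖ ≤ 2^{−kExp σ I k}`, the `hfinal` of sub-step `k`
follows from `Bw I/(4·2^m)^{gainExp I k} < 1/KTwo`. [cite: Yu2013, Lemma 5.2 (5.28)–(5.31); shape only] -/
theorem kstep_hfinal_of_gain {I k : ℕ} (hBw : 0 ≤ σ.Bw I) (hΛ : ‖S.Λ₀‖ ≤ ((2 : ℝ) ^ kExp σ I k)⁻¹)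
    {x₁ : ℤ} {τ : Tau S.d} (hB : σ.Bw I / (4 * (2 : ℝ) ^ σ.m) ^ gainExp σ I k < 1 / KTwo σ I x₁ τ) :
    max (σ.Bw I * ‖S.Λ₀‖ * (2 : ℝ) ^ σ.tdec I * (2 : ℝ) ^ condExp 2 (2 * σ.Nsub I k + 1) (σ.tdec I))
        (σ.Bw I / (4 * (2 : ℝ) ^ σ.m) ^ gainExp σ I k) < 1 / KTwo σ I x₁ τ :=
  max_lt (lt_of_le_of_lt (first_le_gain hBw hΛ) hB) hB

/-- **One third-step inequality from its gain branch**: with `‖Λ₀‖ ≤ 2^{−tExp σ I}`, the `hfinal` of the third step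
at level `I` follows from `Bw I/(4·2^m)^{(2Nfin I+1)·t₃} < (threshold)`. [cite: Yu2013, Lemma 5.4; shape only] -/
theorem third_hfinal_of_gain {I : ℕ} (hBw : 0 ≤ σ.Bw I) (hΛ : ‖S.Λ₀‖ ≤ ((2 : ℝ) ^ tExp σ I)⁻¹) {R : ℝ}
    (hB : σ.Bw I / (4 * (2 : ℝ) ^ σ.m) ^ ((2 * σ.Nfin I + 1) * (σ.Tfin I - σ.T0 (I + 1))) < R) :
    max (σ.Bw I * ‖S.Λ₀‖ * (2 : ℝ) ^ (σ.Tfin I - σ.T0 (I + 1)) *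
          (2 : ℝ) ^ condExp 2 (2 * σ.Nfin I + 1) (σ.Tfin I - σ.T0 (I + 1)))
        (σ.Bw I / (4 * (2 : ℝ) ^ σ.m) ^ ((2 * σ.Nfin I + 1) * (σ.Tfin I - σ.T0 (I + 1)))) < R :=
  max_lt (lt_of_le_of_lt (first_le_gain hBw hΛ) hB) hB

/-! ### The record's reduced obligation lists -/

/-- **ALL k-step inequalities (both branches, every level `I ≤ I*`, every sub-step) from the gain branches and
ONE smallness exponent** `U` dominating every `kExp σ I k`. [cite: Yu2013, Lemma 5.2; shape only] -/
theorem hL2_of_gain (hBw : ∀ I, 0 ≤ σ.Bw I) {U : ℕ}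
    (hU : ∀ I, I ≤ σ.Istar → ∀ k, k < σ.kst I → kExp σ I k ≤ U) (hΛ : ‖S.Λ₀‖ ≤ ((2 : ℝ) ^ U)⁻¹)
    (hgain : ∀ I, I ≤ σ.Istar → ∀ k, k < σ.kst I → ∀ x₁ : ℤ, |x₁| ≤ (σ.Nsub I (k + 1) : ℤ) →
      ∀ τ : Tau S.d, tauNorm τ + σ.tdec I ≤ σ.T0 I - k * σ.tdec I →
      σ.Bw I / (4 * (2 : ℝ) ^ σ.m) ^ gainExp σ I k < 1 / KTwo σ I x₁ τ) :
    ∀ I, I ≤ σ.Istar → ∀ k, k < σ.kst I → ∀ x₁ : ℤ, |x₁| ≤ (σ.Nsub I (k + 1) : ℤ) →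
      ∀ τ : Tau S.d, tauNorm τ + σ.tdec I ≤ σ.T0 I - k * σ.tdec I →
      max (σ.Bw I * ‖S.Λ₀‖ * (2 : ℝ) ^ σ.tdec I * (2 : ℝ) ^ condExp 2 (2 * σ.Nsub I k + 1) (σ.tdec I))
          (σ.Bw I / (4 * (2 : ℝ) ^ σ.m) ^ gainExp σ I k) < 1 / KTwo σ I x₁ τ :=
  fun I hI k hk x₁ hx₁ τ hτ =>
    kstep_hfinal_of_gain σ (hBw I) (le_inv_two_pow_of_le (hU I hI k hk) hΛ) (hgain I hI k hk x₁ hx₁ τ hτ)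

/-- **ALL third-step inequalities (both branches, every level `I < I*`) from the gain branches and ONE smallness
exponent** `U` dominating every `tExp σ I`. [cite: Yu2013, Lemma 5.4; shape only] -/
theorem hL3_of_gain (hBw : ∀ I, 0 ≤ σ.Bw I) {U : ℕ} (hU : ∀ I, I < σ.Istar → tExp σ I ≤ U)
    (hΛ : ‖S.Λ₀‖ ≤ ((2 : ℝ) ^ U)⁻¹)
    (hgain : ∀ I, I < σ.Istar → ∀ s : ℤ, |s| ≤ (σ.N0 (I + 1) : ℤ) → ¬ (3 : ℤ) ∣ s →
      ∀ τ : Tau S.d, tauNorm τ < σ.T0 (I + 1) →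
      σ.Bw I / (4 * (2 : ℝ) ^ σ.m) ^ ((2 * σ.Nfin I + 1) * (σ.Tfin I - σ.T0 (I + 1))) <
        1 / (6 * (thirdDen σ I s τ : ℝ) * thirdM σ I s τ * heightProd S.toQ.all ^ 5) ^ (3 ^ (S.d + 1 + 1) - 1)) :
    ∀ I, I < σ.Istar → ∀ s : ℤ, |s| ≤ (σ.N0 (I + 1) : ℤ) → ¬ (3 : ℤ) ∣ s →
      ∀ τ : Tau S.d, tauNorm τ < σ.T0 (I + 1) →
      max (σ.Bw I * ‖S.Λ₀‖ * (2 : ℝ) ^ (σ.Tfin I - σ.T0 (I + 1)) *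
            (2 : ℝ) ^ condExp 2 (2 * σ.Nfin I + 1) (σ.Tfin I - σ.T0 (I + 1)))
          (σ.Bw I / (4 * (2 : ℝ) ^ σ.m) ^ ((2 * σ.Nfin I + 1) * (σ.Tfin I - σ.T0 (I + 1)))) <
        1 / (6 * (thirdDen σ I s τ : ℝ) * thirdM σ I s τ * heightProd S.toQ.all ^ 5) ^ (3 ^ (S.d + 1 + 1) - 1) :=
  fun I hI s hs h3 τ hτ =>
    third_hfinal_of_gain σ (hBw I) (le_inv_two_pow_of_le (hU I hI) hΛ) (hgain I hI s hs h3 τ hτ)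

/-! ### A priori bounds on the exponents (for the closed form of the closer) -/

/-- `condExp 2 M t ≤ t·(M + log₂(2M))` (each of the `log₂(2M)` dyadic levels costs at most `t·(M/2^{j+1} + 1)`,
and `∑ M/2^{j+1} ≤ M`). [cite: Yu1990, §3; shape only] -/
theorem condExp_two_le (M t : ℕ) : condExp 2 M t ≤ t * (M + Nat.log 2 (2 * M)) := by
  unfold condExp
  have hgeom : ∀ J : ℕ, ∑ j ∈ range J, M / 2 ^ (j + 1) ≤ M - M / 2 ^ J := by
    intro J
    induction J with
    | zero => simp
    | succ J ih =>
      rw [Finset.sum_range_succ]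
      have h1 : M / 2 ^ (J + 1) = M / 2 ^ J / 2 := by rw [pow_succ, Nat.div_div_eq_div_mul]
      have h2 : M / 2 ^ (J + 1 + 1) = M / 2 ^ (J + 1) / 2 := by rw [pow_succ, Nat.div_div_eq_div_mul]
      have h3 : M / 2 ^ J ≤ M := Nat.div_le_self _ _
      omega
  have hsum : ∑ j ∈ range (Nat.log 2 (2 * M)), M / 2 ^ (j + 1) ≤ M :=
    (hgeom _).trans (Nat.sub_le _ _)
  calc ∑ j ∈ range (Nat.log 2 (2 * M)), t * (M / 2 ^ (j + 1) + 1)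
      = t * (∑ j ∈ range (Nat.log 2 (2 * M)), M / 2 ^ (j + 1) + Nat.log 2 (2 * M)) := by
        rw [← Finset.mul_sum, Finset.sum_add_distrib, Finset.sum_const, Finset.card_range, smul_eq_mul,
          mul_one]
    _ ≤ t * (M + Nat.log 2 (2 * M)) := Nat.mul_le_mul_left _ (Nat.add_le_add_right hsum _)

/-- `gainExp σ I k ≤ (2·Nsub I k + 1)·tdec I` for every sub-step. [folklore] -/
theorem gainExp_le (I k : ℕ) : gainExp σ I k ≤ (2 * σ.Nsub I k + 1) * σ.tdec I := by
  unfold gainExp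
  split_ifs with h
  · subst h
    exact Nat.mul_le_mul_right _ (by omega)
  · exact le_rfl

/-- **A priori bound for the k-step exponent**: `kExp σ I k ≤ (m + 4)·(2N+1 + log₂(2(2N+1)))·tdec I`,
`N = Nsub I k`. [folklore] -/
theorem kExp_le (I k : ℕ) :
    kExp σ I k ≤ (σ.m + 4) * ((2 * σ.Nsub I k + 1 + Nat.log 2 (2 * (2 * σ.Nsub I k + 1))) * σ.tdec I) := by
  unfold kExp
  have h1 := condExp_two_le (2 * σ.Nsub I k + 1) (σ.tdec I)
  have h2 := gainExp_le σ I k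
  set M := 2 * σ.Nsub I k + 1
  set t := σ.tdec I
  set l := Nat.log 2 (2 * M)
  have h3 : (σ.m + 2) * gainExp σ I k ≤ (σ.m + 2) * (M * t) := Nat.mul_le_mul_left _ h2
  have h4 : t ≤ (M + l) * t := Nat.le_mul_of_pos_left t (by omega)
  calc t + condExp 2 M t + (σ.m + 2) * gainExp σ I k
      ≤ (M + l) * t + t * (M + l) + (σ.m + 2) * ((M + l) * t) := by
        have : M * t ≤ (M + l) * t := Nat.mul_le_mul_right _ (by omega)
        nlinarith
    _ = (σ.m + 4) * ((M + l) * t) := by ring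

/-- **A priori bound for the third-step exponent**: `tExp σ I ≤ (m + 4)·(2Nfin I+1 + log₂(2(2Nfin I+1)))·t₃`.
[folklore] -/
theorem tExp_le (I : ℕ) :
    tExp σ I ≤ (σ.m + 4) * ((2 * σ.Nfin I + 1 + Nat.log 2 (2 * (2 * σ.Nfin I + 1))) *
      (σ.Tfin I - σ.T0 (I + 1))) := by
  unfold tExp
  have h1 := condExp_two_le (2 * σ.Nfin I + 1) (σ.Tfin I - σ.T0 (I + 1))
  set M := 2 * σ.Nfin I + 1
  set t := σ.Tfin I - σ.T0 (I + 1)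
  set l := Nat.log 2 (2 * M)
  calc t + condExp 2 M t + (σ.m + 2) * (M * t)
      ≤ (M + l) * t + t * (M + l) + (σ.m + 2) * ((M + l) * t) := by
        have : M * t ≤ (M + l) * t := Nat.mul_le_mul_right _ (by omega)
        have h4 : t ≤ (M + l) * t := Nat.le_mul_of_pos_left t (by omega)
        nlinarith
    _ = (σ.m + 4) * ((M + l) * t) := by ring

end TwoSetup

end Summit.ABC.StewartYu

end
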